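import Summits.QuantumFields.YangMills.Theorems.HyperbolicRegulatorHyperbolicToTorusDefs

/-!
# Route `HyperbolicRegulator`, crux `HyperbolicToTorus` (stmt-QuantumFields-15827), line `no_admissible_complex` (v3):
# registered stub `stub_coneFrame` — existence of a cone frame

In an admissible complex (`Adm k j V E Q σ τ bd cV cE`) at curvature scale `k ≥ 8` there is a CONE FRAME
`ConeFrame k V E σ τ c x`: a cone `c`, a flat vertex `x` at graph distance exactly `k/4 + 1` from `c`, lying on a
geodesic from `c` to a deep vertex `p`. Proof: take a deep vertex `p` (axiom 8) and a cone `c` within distance `k`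
of `p` (axiom 5); since `p` is deep, `D := dist c p > k/2`, so `D ≠ 0` and `c`, `p` are joined by a geodesic walk `W`
of length `D`. Put `n := k/4 + 1 ≤ D` and `x := W.getVert n`. Then `dist c x = n` and `dist x p = D - n` (a geodesic
splits additively at each of its vertices), `x ∈ V` (it is an endpoint of an edge of `W`, axiom 1), and `x` is flat:
`dist x c = n > k/4`, while for a cone `c' ≠ c` axiom 6 and the triangle inequality give
`k ≤ dist c c' ≤ n + dist x c'`, i.e. `dist x c' ≥ k - n > k/4` as `k ≥ 8`. Folklore graph-metric bookkeeping
(`Mathlib.Combinatorics.SimpleGraph.Metric`); no published theorem is restated.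
-/

set_option autoImplicit false

namespace Summit.QuantumFields.YangMills.Cruxes.HyperbolicToTorus.NoAdmissibleComplex

open Finset

namespace StubConeFrame

/-- **Geodesic splitting.** If `W : G.Walk c p` realises the distance (`W.length = G.dist c p`) and `n ≤ W.length`,
then the `n`-th vertex `x := W.getVert n` of `W` satisfies `G.dist c x = n` and `G.dist x p = W.length - n`
(from `dist_le` on `W.take n`, `W.drop n` and the triangle inequality at the reachable pair `c`, `x`). -/
theorem dist_getVert_of_geodesic {G : SimpleGraph ℕ} {c p : ℕ} (W : G.Walk c p) (hW : W.length = G.dist c p)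
    {n : ℕ} (hn : n ≤ W.length) :
    G.dist c (W.getVert n) = n ∧ G.dist (W.getVert n) p = W.length - n := by
  have h1 : G.dist c (W.getVert n) ≤ n := by
    have h := SimpleGraph.dist_le (W.take n)
    rw [SimpleGraph.Walk.take_length] at h
    exact h.trans (min_le_left _ _)
  have h2 : G.dist (W.getVert n) p ≤ W.length - n := by
    have h := SimpleGraph.dist_le (W.drop n)
    rwa [SimpleGraph.Walk.drop_length] at h
  have h3 : G.dist c p ≤ G.dist c (W.getVert n) + G.dist (W.getVert n) p :=
    (W.take n).reachable.dist_triangle_left p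
  omega

variable {k j : ℕ} {V E Q : Finset ℕ} {σ τ : ℕ → ℕ} {bd : ℕ → Fin 4 → ℕ × Bool} {cV : ℕ → ℤ × ℤ → ℕ}
  {cE : ℕ → ℤ × ℤ → Fin 2 → ℕ × Bool}

/-- In an admissible complex every `graphOf`-neighbour is a vertex of `V` (axiom 1: edges have endpoints in `V`). -/
theorem mem_of_adj (hA : Adm k j V E Q σ τ bd cV cE) {a b : ℕ} (h : (graphOf E σ τ).Adj a b) : b ∈ V := by
  rw [graphOf_adj] at h
  obtain ⟨_, ⟨e, he, _, rfl⟩ | ⟨e, he, rfl, _⟩⟩ := h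
  · exact (hA.edges e he).2.1
  · exact (hA.edges e he).1

end StubConeFrame

/-- **Registered stub CONE FRAME** of the skeleton `Lines/no_admissible_complex.lean` v3: an admissible complex with
`k ≥ 8` has a cone frame. Take a deep vertex `p` (`Adm.deep`), a cone `c` with `dist p c ≤ k` (`Adm.dense`), a geodesic
walk `W` from `c` to `p` (its length `dist c p > k/2` is nonzero as `p` is deep), and `x := W.getVert (k/4 + 1)`:
geodesic splitting (`StubConeFrame.dist_getVert_of_geodesic`) gives `dist c x = k/4 + 1` and
`dist c p = dist c x + dist x p`; `x ∈ V` by `StubConeFrame.mem_of_adj`; `x` is flat by `Adm.separated` and the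
triangle inequality. -/
theorem stub_coneFrame :
    ∀ (k j : ℕ) (V E Q : Finset ℕ) (σ τ : ℕ → ℕ) (bd : ℕ → Fin 4 → ℕ × Bool) (cV : ℕ → ℤ × ℤ → ℕ) (cE : ℕ → ℤ × ℤ → Fin 2 → ℕ × Bool), 8 ≤ k → Adm k j V E Q σ τ bd cV cE → ∃ c x : ℕ, ConeFrame k V E σ τ c x := by
  intro k j V E Q σ τ bd cV cE hk hA
  obtain ⟨p, _, hp, _, _⟩ := hA.deep
  obtain ⟨c, hc, _⟩ := hA.dense p hp.1
  have hDgt : k / 2 < (graphOf E σ τ).dist c p := by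
    rw [SimpleGraph.dist_comm]
    exact hp.2 c hc
  have hD0 : (graphOf E σ τ).dist c p ≠ 0 := by omega
  obtain ⟨W, hW⟩ := SimpleGraph.exists_walk_of_dist_ne_zero hD0
  have hnW : k / 4 + 1 ≤ W.length := by omega
  obtain ⟨hcx, hxp⟩ := StubConeFrame.dist_getVert_of_geodesic W hW hnW
  have hreach : (graphOf E σ τ).Reachable c (W.getVert (k / 4 + 1)) := (W.take (k / 4 + 1)).reachable
  have hxV : W.getVert (k / 4 + 1) ∈ V := by
    have hlt : k / 4 < W.length := by omega
    exact StubConeFrame.mem_of_adj hA (W.adj_getVert_succ hlt)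
  have hflat : IsFlatAt k V E σ τ (W.getVert (k / 4 + 1)) := by
    refine ⟨hxV, fun c' hc' => ?_⟩
    by_cases hcc' : c = c'
    · subst hcc'
      rw [SimpleGraph.dist_comm, hcx]
      exact Nat.lt_succ_self _
    · have hsep := hA.separated c hc c' hc' hcc'
      have htri := hreach.dist_triangle_left c'
      omega
  refine ⟨c, W.getVert (k / 4 + 1), hc, hflat, ?_, p, hp, ?_⟩
  · rw [SimpleGraph.dist_comm, hcx]
  · omega

end Summit.QuantumFields.YangMills.Cruxes.HyperbolicToTorus.NoAdmissibleComplex
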